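import Literature.MathematicalPhysics.QuantumFieldTheory.Balaban1983to89.Beta.PlaquetteStencil

/-!
# `Beta.PlaquetteBackground` — the first-order vertex operator of the Wilson action for EVERY background:
# `−½·jet21 ℝ τ e (field t v) B = ½·vᵀ(Σ_z Σ_γ wilsonVertex₁ e z γ (adM (B_γ(z))))v`, and Bałaban's letters with the background in coordinates

HONEST FRAMING (cell `pub-balaban`, β sub-cell, analysis prover AN3, generation 11, fourth node).  Discharging `BetaPertH`
would make Bałaban's ultraviolet stability UNCONDITIONAL — a real constructive-QFT result; it is NOT the continuum limit and NOT
the Clay problem.  This file discharges nothing of the kind: it is FINITE NON-COMMUTATIVE ALGEBRA on a finite periodic lattice in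
coordinates, kernel-checked, continuing `Beta.PlaquetteVertex` (the `(2,1)`-jet), `Beta.PlaquetteWeitzenbock` (the lattice Weitzenböck identity)
and `Beta.PlaquetteStencil` (the one-bond vertex as a finite matrix).  Value = a kernel certificate for the β-function bookkeeping «which term of the
ACTUAL plaquette action produces which table coefficient» (the `(D1-rep)` dictionary of the cell), NOT summit progress.

ABSOLUTE RULE.  No internally-minted statement enters as a cited fact.  Every statement below is kernel-proved; the only literature locus
named (T. Bałaban, *Propagators for lattice gauge theories in a background field*, Comm. Math. Phys. **99** (1985) 389–434
[Balaban1985BackgroundPropagators] = cell paper B9, pp. 391–392: the expansion (3.7) of the Wilson action around a background `U`, its quadratic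
form (3.10) `⟨A, Δ(U)A⟩`, (3.12)) is CONTEXT for the reader — the printed operator `Δ(U)` at first order in the background letters is what the matrix
below is the germ of — and nothing printed is used as a hypothesis.  The manuscripts under audit are not citable for their disputed steps and are
not cited for any step here.

WHAT IS PROVED.  Setting of `PlaquetteVertex` §3 / `PlaquetteStencil`: real algebra `𝔸`, tracial `τ`, colour letters `t : C → 𝔸`, finite periodic
lattice `Λ`, frame `e : D → Λ`, fluctuation `W = field t v`, background letter field `B : Λ → D → 𝔸` — now ARBITRARY.

* §1 ADDITIVITY IN THE BACKGROUND.  `spinLocal`, `spinDiff`, `twistW`, `transport` are additive in `B` and vanish at `B = 0`; hence, for tracial `τ`,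
  `jet21 𝕜 τ e W (B + B′) = jet21 𝕜 τ e W B + jet21 𝕜 τ e W B′` (`jet21_add_bg`, via `PlaquetteVertex.jet21_split`), `jet21_zero_bg`, and
  `jet21 𝕜 τ e W (Σ_{i∈s} B_i) = Σ_{i∈s} jet21 𝕜 τ e W B_i` (`jet21_sum_bg`).
* §2 THE BOND-LETTER DECOMPOSITION `B = Σ_z Σ_γ bondLetter z γ (B_γ(z))` (`background_eq_sum_bondLetter`).
* §3 **HEADLINE** (`actionJet21_eq_wilsonVertexOp`).  `wilsonVertexOp e A := Σ_z Σ_γ PlaquetteStencil.wilsonVertex₁ e z γ (A z γ)` and, for EVERY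
  background `B`, EVERY fluctuation `v` and tracial `τ`:
  `−½·jet21 ℝ τ e (field t v) B = ½ · v ⬝ᵥ (wilsonVertexOp e (fun z γ => adM τ t (B z γ)) *ᵥ v)` — the `B`-linear part of the Wilson Hessian is
  ONE finite matrix, linear in the background, assembled bond by bond from `PlaquetteStencil`'s one-bond vertices (model vector vertex +
  longitudinal vertex + explicit remainder vertex per bond).
* §4 THE BACKGROUND IN COORDINATES.  `adM τ t (Σ_c β_c • F_c) = Σ_c β_c • adM τ t F_c` (`adM_sum_smul`); with `B = field t b`
  (`B_γ(z) = Σ_c b(z,c,γ)·t_c`, the same coordinates as the fluctuation): `adM τ t (field t b z γ) = Σ_c b(z,c,γ) • adM τ t (t_c)` and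
  `−½·jet21 ℝ τ e (field t v) (field t b) = ½ · v ⬝ᵥ (wilsonVertexOp e (fun z γ => Σ_c b(z,c,γ) • adM τ t (t c)) *ᵥ v)`
  (`actionJet21_eq_wilsonVertexOp_field`) — the full `(2,1)` coupling of background coordinates `b` and fluctuation coordinates `v`.
* §5 BAŁABAN'S LETTERS VERBATIM (`actionJet21_eq_wilsonVertexOp_gen`): `t = gen τ = (I•τ_c)_c`, `τ = rntr`, colour matrices
  `ColourTrace.adMat τ (τ c)`: `−½·jet21 ℝ rntr e (field (gen τ) v) (field (gen τ) b) = ½ · v ⬝ᵥ (wilsonVertexOp e (fun z γ => Σ_c b(z,c,γ) •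
  adMat τ (τ c)) *ᵥ v)` — no hypothesis on the generator family.

NOT PROVED HERE, NOT CLAIMED: any estimate, norm or table value of `wilsonVertexOp`; the `(2,2)` family (P22); gauge fixing; anything about
`BetaPertH`, the continuum limit or the Clay problem.  All declarations are tagged `[folklore]`: finite algebra.
-/

namespace Literature.MathematicalPhysics.QuantumFieldTheory.Balaban1983to89.Beta.PlaquetteBackground

open Finset
open scoped BigOperators Matrix
open Literature.MathematicalPhysics.QuantumFieldTheory.Balaban1983to89.Beta.SpinTable (br)
open Literature.MathematicalPhysics.QuantumFieldTheory.Balaban1983to89.Beta.ColourTrace (adMat)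
open Literature.MathematicalPhysics.QuantumFieldTheory.Balaban1983to89.Beta.PlaquetteVertex
open Literature.MathematicalPhysics.QuantumFieldTheory.Balaban1983to89.Beta.PlaquetteWeitzenbock
open Literature.MathematicalPhysics.QuantumFieldTheory.Balaban1983to89.Beta.PlaquetteStencil

/-! ## §1 Additivity of the forms in the background -/

section Additivity

variable {𝕜 : Type*} [Semiring 𝕜] {𝔸 : Type*} [Ring 𝔸] [Module 𝕜 𝔸] {V : Type*} [AddCommGroup V] [Module 𝕜 V]
variable {Λ : Type*} [Fintype Λ] [AddCommGroup Λ] {D : Type*} [Fintype D]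

/-- the local spin form is additive in the background. [folklore] -/
theorem spinLocal_add_bg (τ : 𝔸 →ₗ[𝕜] V) (e : D → Λ) (W B B' : Λ → D → 𝔸) :
    spinLocal τ e W (B + B') = spinLocal τ e W B + spinLocal τ e W B' := by
  simp only [spinLocal, lcurl_add, add_mul, map_add, Finset.sum_add_distrib]

/-- the local spin form vanishes at zero background. [folklore] -/
theorem spinLocal_zero_bg (τ : 𝔸 →ₗ[𝕜] V) (e : D → Λ) (W : Λ → D → 𝔸) : spinLocal τ e W 0 = 0 := by
  simp [spinLocal, lcurl]

/-- the difference spin form is additive in the background. [folklore] -/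
theorem spinDiff_add_bg (τ : 𝔸 →ₗ[𝕜] V) (e : D → Λ) (W B B' : Λ → D → 𝔸) :
    spinDiff τ e W (B + B') = spinDiff τ e W B + spinDiff τ e W B' := by
  simp only [spinDiff, lcurl_add, add_mul, map_add, Finset.sum_add_distrib]

/-- the difference spin form vanishes at zero background. [folklore] -/
theorem spinDiff_zero_bg (τ : 𝔸 →ₗ[𝕜] V) (e : D → Λ) (W : Λ → D → 𝔸) : spinDiff τ e W 0 = 0 := by
  simp [spinDiff, lcurl]

omit [Fintype Λ] [Fintype D] in
/-- the transport twist is additive in the background. [folklore] -/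
theorem twistW_add_bg (e : D → Λ) (W B B' : Λ → D → 𝔸) (x : Λ) (μ ν : D) :
    twistW e W (B + B') x μ ν = twistW e W B x μ ν + twistW e W B' x μ ν := by
  simp only [twistW, Pi.add_apply, br]
  noncomm_ring

omit [Fintype Λ] [Fintype D] in
/-- the transport twist vanishes at zero background. [folklore] -/
theorem twistW_zero_bg (e : D → Λ) (W : Λ → D → 𝔸) (x : Λ) (μ ν : D) : twistW e W 0 x μ ν = 0 := by
  simp [twistW, br]

/-- the transport form is additive in the background. [folklore] -/
theorem transport_add_bg (τ : 𝔸 →ₗ[𝕜] V) (e : D → Λ) (W B B' : Λ → D → 𝔸) :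
    transport τ e W (B + B') = transport τ e W B + transport τ e W B' := by
  simp only [transport, twistW_add_bg, mul_add, map_add, Finset.sum_add_distrib]

/-- the transport form vanishes at zero background. [folklore] -/
theorem transport_zero_bg (τ : 𝔸 →ₗ[𝕜] V) (e : D → Λ) (W : Λ → D → 𝔸) : transport τ e W 0 = 0 := by
  simp [transport, twistW_zero_bg]

end Additivity

section JetAdditivity

variable (𝕜 : Type*) [RCLike 𝕜] {𝔸 : Type*} [NormedRing 𝔸] [NormedAlgebra 𝕜 𝔸]
variable {V : Type*} [AddCommGroup V] [Module 𝕜 V]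
variable {Λ : Type*} [Fintype Λ] [AddCommGroup Λ] {D : Type*} [Fintype D]

/-- **THE WILSON `(2,1)`-JET IS ADDITIVE IN THE BACKGROUND** (tracial `τ`; via the three-form split `jet21_split`). [folklore] -/
theorem jet21_add_bg (τ : 𝔸 →ₗ[𝕜] V) (hτ : ∀ a b : 𝔸, τ (a * b) = τ (b * a)) (e : D → Λ) (W B B' : Λ → D → 𝔸) :
    jet21 𝕜 τ e W (B + B') = jet21 𝕜 τ e W B + jet21 𝕜 τ e W B' := by
  rw [jet21_split 𝕜 τ hτ, jet21_split 𝕜 τ hτ, jet21_split 𝕜 τ hτ, spinLocal_add_bg, spinDiff_add_bg, transport_add_bg, smul_add]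
  abel

/-- the Wilson `(2,1)`-jet vanishes at zero background (tracial `τ`). [folklore] -/
theorem jet21_zero_bg (τ : 𝔸 →ₗ[𝕜] V) (hτ : ∀ a b : 𝔸, τ (a * b) = τ (b * a)) (e : D → Λ) (W : Λ → D → 𝔸) :
    jet21 𝕜 τ e W 0 = 0 := by
  rw [jet21_split 𝕜 τ hτ, spinLocal_zero_bg, spinDiff_zero_bg, transport_zero_bg, smul_zero, add_zero, add_zero]

/-- the Wilson `(2,1)`-jet of a finite sum of backgrounds (tracial `τ`). [folklore] -/
theorem jet21_sum_bg {ι : Type*} (τ : 𝔸 →ₗ[𝕜] V) (hτ : ∀ a b : 𝔸, τ (a * b) = τ (b * a)) (e : D → Λ) (W : Λ → D → 𝔸)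
    (s : Finset ι) (Bf : ι → Λ → D → 𝔸) :
    jet21 𝕜 τ e W (∑ i ∈ s, Bf i) = ∑ i ∈ s, jet21 𝕜 τ e W (Bf i) := by
  classical
  induction s using Finset.induction_on with
  | empty => rw [Finset.sum_empty, Finset.sum_empty, jet21_zero_bg 𝕜 τ hτ]
  | @insert i s hi ih => rw [Finset.sum_insert hi, Finset.sum_insert hi, jet21_add_bg 𝕜 τ hτ, ih]

end JetAdditivity

/-! ## §2 The bond-letter decomposition of a background -/

section Decomposition

variable {M : Type*} [AddCommGroup M]
variable {Λ : Type*} [Fintype Λ] [DecidableEq Λ] {D : Type*} [Fintype D] [DecidableEq D]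

/-- **EVERY BACKGROUND IS THE SUM OF ITS BOND LETTERS**: `B = Σ_z Σ_γ bondLetter z γ (B_γ(z))`. [folklore] -/
theorem background_eq_sum_bondLetter (B : Λ → D → M) : B = ∑ z, ∑ γ, bondLetter z γ (B z γ) := by
  funext x δ
  simp only [Finset.sum_apply, bondLetter]
  rw [Finset.sum_eq_single_of_mem x (Finset.mem_univ x)]
  · rw [Finset.sum_eq_single_of_mem δ (Finset.mem_univ δ)]
    · rw [if_pos ⟨rfl, rfl⟩]
    · intro γ _ hγ
      rw [if_neg (fun h => hγ h.2.symm)]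
  · intro z _ hz
    exact Finset.sum_eq_zero fun γ _ => if_neg (fun h => hz h.1.symm)

end Decomposition

/-! ## §3 Headline: the first-order vertex operator for every background -/

section Operator

variable {Λ : Type*} [Fintype Λ] [DecidableEq Λ] [AddCommGroup Λ] {C : Type*} [Fintype C] [DecidableEq C]
  {D : Type*} [Fintype D] [DecidableEq D]

/-- **THE FIRST-ORDER VERTEX OPERATOR** of the Wilson action for a background with colour matrices `A : Λ → D → Matrix C C ℝ` (one per bond):
`wilsonVertexOp e A := Σ_z Σ_γ wilsonVertex₁ e z γ (A z γ)` — the bond-by-bond sum of `PlaquetteStencil`'s one-bond vertices.  A definition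
asserting nothing. [folklore] -/
noncomputable def wilsonVertexOp (e : D → Λ) (A : Λ → D → Matrix C C ℝ) : Matrix (Λ × (C × D)) (Λ × (C × D)) ℝ :=
  ∑ z, ∑ γ, wilsonVertex₁ e z γ (A z γ)

end Operator

section Headline

variable {𝔸 : Type*} [NormedRing 𝔸] [NormedAlgebra ℝ 𝔸]
variable {Λ : Type*} [Fintype Λ] [DecidableEq Λ] [AddCommGroup Λ] {C : Type*} [Fintype C] [DecidableEq C]
  {D : Type*} [Fintype D] [DecidableEq D]

omit [DecidableEq C] in
/-- **HEADLINE — THE `B`-LINEAR PART OF THE WILSON HESSIAN IS ONE FINITE MATRIX, LINEAR IN THE BACKGROUND, FOR EVERY BACKGROUND.**  In the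
Hessian convention `S₂ = ½·vᵀHv` for `S = Σ_p (1 − Re τU(∂p))` (`(2,1)`-jet `= −½·jet21`; B9 (3.7)/(3.10)/(3.12) are where the printed operator
`Δ(U)` lives — context only), for EVERY background letter field `B`, EVERY fluctuation in coordinates `v` and every tracial `τ`:
`−½·jet21 ℝ τ e (field t v) B = ½ · v ⬝ᵥ (wilsonVertexOp e (fun z γ => adM τ t (B z γ)) *ᵥ v)`. [folklore] -/
theorem actionJet21_eq_wilsonVertexOp (τ : 𝔸 →ₗ[ℝ] ℝ) (hτ : ∀ a b : 𝔸, τ (a * b) = τ (b * a)) (t : C → 𝔸) (e : D → Λ)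
    (v : Λ × (C × D) → ℝ) (B : Λ → D → 𝔸) :
    -((2 : ℝ)⁻¹ * jet21 ℝ τ e (field t v) B) = (2 : ℝ)⁻¹ * (v ⬝ᵥ (wilsonVertexOp e (fun z γ => adM τ t (B z γ)) *ᵥ v)) := by
  conv_lhs => rw [background_eq_sum_bondLetter B]
  rw [jet21_sum_bg ℝ τ hτ, wilsonVertexOp, dotProduct_sum_mulVec, Finset.mul_sum, Finset.mul_sum, ← Finset.sum_neg_distrib]
  refine Finset.sum_congr rfl fun z _ => ?_
  rw [jet21_sum_bg ℝ τ hτ, dotProduct_sum_mulVec, Finset.mul_sum, Finset.mul_sum, ← Finset.sum_neg_distrib]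
  refine Finset.sum_congr rfl fun γ _ => ?_
  exact actionJet21_eq_wilsonVertex₁ τ hτ t e v z γ (B z γ)

end Headline

/-! ## §4 The background in coordinates -/

section BackgroundCoordinates

variable {𝔸 : Type*} [Ring 𝔸] [Algebra ℝ 𝔸] {C : Type*} [Fintype C] [DecidableEq C]

omit [Fintype C] [DecidableEq C] in
/-- `adM` is linear in the letter: `adM τ t (Σ_c β_c • F_c) = Σ_c β_c • adM τ t F_c`. [folklore] -/
theorem adM_sum_smul {ι : Type*} (τ : 𝔸 →ₗ[ℝ] ℝ) (t : C → 𝔸) (s : Finset ι) (β : ι → ℝ) (F : ι → 𝔸) :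
    adM τ t (∑ c ∈ s, β c • F c) = ∑ c ∈ s, β c • adM τ t (F c) := by
  ext a b
  simp only [adM_apply, Finset.sum_mul, smul_mul_assoc, map_sum, map_smul, smul_eq_mul, Matrix.sum_apply, Matrix.smul_apply]

omit [DecidableEq C] in
/-- the colour matrix of a background letter in coordinates: `adM τ t (field t b z γ) = Σ_c b(z,c,γ) • adM τ t (t c)`. [folklore] -/
theorem adM_field {Λ : Type*} {D : Type*} (τ : 𝔸 →ₗ[ℝ] ℝ) (t : C → 𝔸) (b : Λ × (C × D) → ℝ) (z : Λ) (γ : D) :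
    adM τ t (field t b z γ) = ∑ c, b (z, (c, γ)) • adM τ t (t c) :=
  adM_sum_smul τ t Finset.univ (fun c => b (z, (c, γ))) t

end BackgroundCoordinates

section HeadlineCoordinates

variable {𝔸 : Type*} [NormedRing 𝔸] [NormedAlgebra ℝ 𝔸]
variable {Λ : Type*} [Fintype Λ] [DecidableEq Λ] [AddCommGroup Λ] {C : Type*} [Fintype C] [DecidableEq C]
  {D : Type*} [Fintype D] [DecidableEq D]

omit [DecidableEq C] in
/-- **THE FULL `(2,1)` COUPLING IN COORDINATES**: background `B = field t b` and fluctuation `W = field t v` in the SAME coordinates;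
`−½·jet21 ℝ τ e (field t v) (field t b) = ½ · v ⬝ᵥ (wilsonVertexOp e (fun z γ => Σ_c b(z,c,γ) • adM τ t (t c)) *ᵥ v)` — a finite matrix depending
linearly on `b`, i.e. ONE finite cubic coupling tensor (tracial `τ`). [folklore] -/
theorem actionJet21_eq_wilsonVertexOp_field (τ : 𝔸 →ₗ[ℝ] ℝ) (hτ : ∀ a b : 𝔸, τ (a * b) = τ (b * a)) (t : C → 𝔸) (e : D → Λ)
    (v b : Λ × (C × D) → ℝ) :
    -((2 : ℝ)⁻¹ * jet21 ℝ τ e (field t v) (field t b)) =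
      (2 : ℝ)⁻¹ * (v ⬝ᵥ (wilsonVertexOp e (fun z γ => ∑ c, b (z, (c, γ)) • adM τ t (t c)) *ᵥ v)) := by
  rw [actionJet21_eq_wilsonVertexOp τ hτ]
  simp only [adM_field]

end HeadlineCoordinates

/-! ## §5 Bałaban's letters verbatim -/

section BalabanLetters

open ColourTrace

attribute [local instance] Matrix.linftyOpNormedRing Matrix.linftyOpNormedAlgebra

variable {N : ℕ} {C : Type*} [Fintype C] [DecidableEq C]
variable {Λ : Type*} [Fintype Λ] [DecidableEq Λ] [AddCommGroup Λ] {D : Type*} [Fintype D] [DecidableEq D]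

omit [DecidableEq C] [Fintype Λ] [DecidableEq Λ] [AddCommGroup Λ] [Fintype D] [DecidableEq D] in
/-- the colour matrix of Bałaban's background letter in coordinates: `adM rntr (gen τ) (field (gen τ) b z γ) = Σ_c b(z,c,γ) • adMat τ (τ c)`.
[folklore] -/
theorem adM_field_gen (τ : C → Matrix (Fin N) (Fin N) ℂ) (b : Λ × (C × D) → ℝ) (z : Λ) (γ : D) :
    adM rntr (gen τ) (field (gen τ) b z γ) = ∑ c, b (z, (c, γ)) • adMat τ (τ c) := by
  rw [adM_field]
  simp only [adM_gen]

omit [DecidableEq C] in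
/-- **BAŁABAN'S LETTERS VERBATIM**: generator family `τ : C → Matrix (Fin N) (Fin N) ℂ`, real normalised trace `rntr`, letters `gen τ c = I•τ c`,
background `field (gen τ) b` and fluctuation `field (gen τ) v` in coordinates:
`−½·jet21 = ½ · v ⬝ᵥ (wilsonVertexOp e (fun z γ => Σ_c b(z,c,γ) • ColourTrace.adMat τ (τ c)) *ᵥ v)` — no hypothesis on the generator family
(any submultiplicative matrix norm, enabled locally as in `PlaquetteVertex` §4). [folklore] -/
theorem actionJet21_eq_wilsonVertexOp_gen (τ : C → Matrix (Fin N) (Fin N) ℂ) (e : D → Λ) (v b : Λ × (C × D) → ℝ) :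
    -((2 : ℝ)⁻¹ * jet21 ℝ rntr e (field (gen τ) v) (field (gen τ) b)) =
      (2 : ℝ)⁻¹ * (v ⬝ᵥ (wilsonVertexOp e (fun z γ => ∑ c, b (z, (c, γ)) • adMat τ (τ c)) *ᵥ v)) := by
  rw [actionJet21_eq_wilsonVertexOp rntr rntr_comm (gen τ) e v (field (gen τ) b)]
  simp only [adM_field_gen]

end BalabanLetters

/-! ## §6 Sanity examples -/

section Examples

variable {Λ : Type*} [Fintype Λ] [DecidableEq Λ] {D : Type*} [Fintype D] [DecidableEq D]

/-- a one-bond background is its own decomposition (all other bond letters vanish). [folklore] -/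
example {M : Type*} [AddCommGroup M] (z : Λ) (γ : D) (Y : M) :
    (bondLetter z γ Y : Λ → D → M) = ∑ z', ∑ γ', bondLetter z' γ' (bondLetter z γ Y z' γ') :=
  background_eq_sum_bondLetter (bondLetter z γ Y)

/-- the zero background decomposes into zero letters. [folklore] -/
example {M : Type*} [AddCommGroup M] : (0 : Λ → D → M) = ∑ z, ∑ γ, bondLetter z γ ((0 : Λ → D → M) z γ) :=
  background_eq_sum_bondLetter 0

end Examples

end Literature.MathematicalPhysics.QuantumFieldTheory.Balaban1983to89.Beta.PlaquetteBackground
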